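import Literature.AlgebraicGeometry.HodgeTheory.CycleClassPrincipalDivisorOffVertex
import Literature.AlgebraicGeometry.HodgeTheory.CycleClassPrincipalDivisorOfProjectiveSpace
import Literature.AlgebraicGeometry.Motives.ProjectiveSpaceRationalPointToVertex
import Mathlib.AlgebraicGeometry.Morphisms.IsIso
import HarnessLib

/-!
# Voisin II, Lemma 9.18 on `ℙ^{d+1}_ℂ` from the degree formula, and Lemma 9.18 for the complex orientations from the spanning hypothesis

Family `hodge`, layer `Literature/AlgebraicGeometry/HodgeTheory`. Completion of the `ℙ^{d+1}`-case of
Voisin's Lemma 9.18 in generator form ("`[div φ] = 0`" for the tree's `cycleClass` through resolution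
families, relative to the complex orientation family), granted Fulton's degree formula for the complex
orientations (`OrientationFamily.HasDegreeFormula`, Lemma 19.1.2, the hypothesis `hA`) — i.e. the
DISCHARGE of the hypothesis predicate `ProjectiveSpaceCycleClassDivEqZero d` of
`HodgeTheory/CycleClassPrincipalDivisorOfProjectiveSpace` from `hA` — and the resulting reduction of
Lemma 9.18 for the complex orientations (`complexOrientationFamily.CycleClassDivEqZero`, the named fact
`Voisin2003_cycleClass_div_eq_zero_complexOrientation` of `ComplexOrientationCycleClassFacts`) to `hA` and
the spanning of the rational `(d,d)`-classes of `(d+1)`-folds by pull-backs from `ℙ^{d+1}`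
(`TopHodgeClassesSpannedByPullbacks`, hard Lefschetz with Lefschetz `(1,1)`).

* `cycleClass_div_eq_zero_of_birational_model` — **transport along a birational model**: for
  `W ⊆ X` closed of dimension `d + 1`, `φ ∈ K(W)ˣ` and a birational `π : T → W` from a smooth projective
  `(d+1)`-fold with `[div_T π^♯φ] = 0`, also `[div_W φ] = 0` (`(π ≫ ι_W)_* div_T π^♯φ = div_W φ`, Fulton
  Prop. 1.4 (b) with `Nm π^♯φ = φ`; `[f_* Z] = f_* [Z]`, Voisin II Prop. 9.21 (ii), from `hA`) — the
  steps of `cycleClassDivEqZero_of_smooth` for a GIVEN model;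
* `isBirational_of_isIso` — isomorphisms are birational;
* `cycleClass_div_eq_zero_projectiveSpace_of_ord` — **`[div ψ] = 0` on `ℙ^{d+1}` for every
  `ψ ∈ K(ℙ^{d+1})ˣ`**: an automorphism of `ℙ^{d+1}` moves the vertex into the (non-empty, open) unit locus
  of `ψ` (`ProjectiveSpace.exists_iso_left_vertex_mem`), and the case of a unit at the vertex is
  `cycleClass_div_eq_zero_of_isUnitAt_vertex` (`HodgeTheory/CycleClassPrincipalDivisorOffVertex`);
* `projectiveSpaceCycleClassDivEqZero_of_hasDegreeFormula` — **`ProjectiveSpaceCycleClassDivEqZero d`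
  from `hA`** (a closed subvariety of `ℙ^{d+1}` of dimension `d + 1` is `ℙ^{d+1}`: transport along `ι_W⁻¹`);
* `cycleClassDivEqZero_complexOrientationFamily_of_spanning` — **Lemma 9.18 for the complex orientation
  family from `hA` and the spanning hypothesis** (`cycleClassDivEqZero_of_smooth` with
  `cycleClass_div_eq_zero_of_projectiveSpace`: the Hodge index route).

Everything is proved; no definitions, no named facts.

## References

* [VoisinHodgeII2003] C. Voisin, Hodge Theory and Complex Algebraic Geometry II, CUP 2003, Lemma 9.18,
  Prop. 9.21 (ii).
* [Fulton1998] W. Fulton, Intersection Theory, 2nd ed. 1998, Prop. 1.4, Lemma 19.1.2.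
* [Hartshorne1977] R. Hartshorne, Algebraic Geometry, GTM 52, II Example 7.1.1.
* [BrosnanFangNiePearlstein2009] P. Brosnan, H. Fang, Z. Nie, G. Pearlstein, Singularities of admissible
  normal functions, Invent. Math. 177 (2009), §6 (6.1).
* [StacksProject] The Stacks Project, Tag 01RN.
-/

noncomputable section

open CategoryTheory AlgebraicGeometry Order TopologicalSpace
open Literature.AlgebraicTopology.SingularHomology
open Literature.AlgebraicGeometry.Motives Literature.AlgebraicGeometry.Resolution

namespace Literature.AlgebraicGeometry.HodgeTheory

section HodgeTheory

variable {n : ℕ} {X : Motives.SchemeOver ℂ}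

/-! ### Transport along a birational model of a full-dimensional closed subvariety -/

/-- **Transport of Lemma 9.18 along a birational model.** Let `X` be smooth projective of dimension
`n = d + e`, `W ⊆ X` a closed subvariety of dimension `d + 1`, `φ ∈ K(W)ˣ`, and let `π : T → W` be a
birational morphism from a smooth projective `(d+1)`-fold `T` (e.g. a desingularisation, or an
isomorphism). If `[div_T(π^♯ φ)] = 0 ∈ H²(T(ℂ); ℂ)`, then `[div_W φ] = 0 ∈ H^{2e}(X(ℂ); ℂ)`: indeed
`(π ≫ ι_W)_* div_T(π^♯ φ) = div_W(Nm π^♯φ) = div_W(φ)` (Fulton Prop. 1.4 (b), the norm of a degree-one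
extension being the identity) and `[f_* Z] = f_* [Z]` (Voisin II Prop. 9.21 (ii), from the degree
formula `hμ`). [cite: VoisinHodgeII2003, Lemma 9.18 (proof) and Prop. 9.21 (ii)]
[cite: Fulton1998, Prop. 1.4 (b)] -/
theorem cycleClass_div_eq_zero_of_birational_model {μ : OrientationFamily} (hμ : μ.HasDegreeFormula)
    (hX : IsSmoothProjective n X) {d e : ℕ} (hde : d + e = n) (ρ : ResolutionFamily X d)
    (W : Motives.ClosedSubvariety X.left) [IsLocallyNoetherian W.carrier] (φ : W.carrier.functionField)
    (hφ : φ ≠ 0) (hW : W.dim = d + 1) {T : Motives.SchemeOver ℂ} (hT : IsSmoothProjective (d + 1) T)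
    [IsIntegral T.left] [IsLocallyNoetherian T.left] (π₀ : T.left ⟶ W.carrier) [IsDominant π₀]
    (hπw : π₀ ≫ W.ι ≫ X.hom = T.hom) (hπ : IsBirational π₀) (ρT : ResolutionFamily T d)
    (hT0 : ∀ ⦃c' : AlgebraicCycle T.left ℤ⦄ (hc' : c' ∈ Motives.cyclesOfDim T.left d),
      (⇑c' = fun z ↦ Scheme.ord (RatFn.functionFieldMap π₀ φ) z) → cycleClass μ hT rfl ρT ⟨c', hc'⟩ = 0)
    {c : AlgebraicCycle X.left ℤ} (hc : c ∈ Motives.cyclesOfDim X.left d) (hcφ : ⇑c = W.divFun φ) :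
    cycleClass μ hX hde ρ ⟨c, hc⟩ = 0 := by
  classical
  haveI : LocallyOfFiniteType X.hom := locallyOfFiniteType_of_isSmoothProjective hX
  haveI : IsIntegral W.toSchemeOver.left := inferInstanceAs (IsIntegral W.carrier)
  haveI : IsLocallyNoetherian W.toSchemeOver.left := inferInstanceAs (IsLocallyNoetherian W.carrier)
  haveI : LocallyOfFiniteType W.toSchemeOver.hom := inferInstanceAs (LocallyOfFiniteType (W.ι ≫ X.hom))
  set ι' : W.toSchemeOver.left ⟶ X.left := W.ιOver.left with hι'def
  haveI : IsClosedImmersion ι' := inferInstanceAs (IsClosedImmersion W.ι)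
  have hWtop : height (⊤ : ↥W.carrier) = (d + 1 : ℕ) := by
    rw [← W.dim_eq_height_top, hW, Nat.cast_add_one]
  haveI : LocallyOfFiniteType T.hom := locallyOfFiniteType_of_isSmoothProjective hT
  haveI := irreducibleSpace_of_isSmoothProjective' hT
  -- `π : T ⟶ W` over `ℂ`; `τ = π ≫ ι_W : T ⟶ X` is proper, so `π` is proper (`ι_W` separated)
  set π : T ⟶ W.toSchemeOver := Over.homMk π₀ hπw with hπdef
  haveI : IsDominant π.left := inferInstanceAs (IsDominant π₀)
  set τ : T ⟶ X := π ≫ W.ιOver with hτdef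
  haveI : IsProper τ.left := isProper_left_of_isSmoothProjective hT hX τ
  have hτleft : τ.left = π.left ≫ ι' := by rw [hτdef, Over.comp_left]
  haveI : IsProper (π.left ≫ ι') := by rw [← hτleft]; infer_instance
  haveI : IsProper π.left := IsProper.of_comp π.left ι'
  -- the pulled-back function `φ' = π^♯ φ ∈ K(T)` and its divisor, a `d`-cycle on `T`
  set φ' : T.left.functionField := RatFn.functionFieldMap π₀ φ with hφ'def
  have hφ' : φ' ≠ 0 := by
    rw [hφ'def]
    exact (map_ne_zero_iff _ (RatFn.functionFieldMap π₀).injective).2 hφ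
  haveI : IsLocallyNoetherian (Motives.ClosedSubvariety.top T.left).carrier :=
    inferInstanceAs (IsLocallyNoetherian T.left)
  set cT : AlgebraicCycle T.left ℤ := (Motives.ClosedSubvariety.top T.left).div
    (Motives.ClosedSubvariety.top T.left).locallyFiniteSupport_divFun_holds φ' with hcTdef
  have hcT : ⇑cT = (Motives.ClosedSubvariety.top T.left).divFun φ' := rfl
  have hcTord : ⇑cT = fun z ↦ Scheme.ord φ' z :=
    hcT.trans (Motives.ClosedSubvariety.divFun_top T.left φ')
  have hTgen : height (genericPoint T.left) = (d + 1 : ℕ) :=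
    height_eq_of_isGenericPoint hT (genericPoint_spec _)
  have hTtop : height (⊤ : ↥T.left) = (d + 1 : ℕ) := hTgen
  have hWT : (Motives.ClosedSubvariety.top T.left).dim = d + 1 := by
    rw [Motives.ClosedSubvariety.dim_top, hTgen, Nat.cast_add_one]
  have hcTdim : cT ∈ Motives.cyclesOfDim T.left d :=
    Motives.divFun_mem_cyclesOfDim_holds T (Motives.ClosedSubvariety.top T.left) hWT hφ' cT hcT
  -- the model case on `T`: `[div_T φ'] = 0`
  have hT0' : cycleClass μ hT rfl ρT ⟨cT, hcTdim⟩ = 0 := hT0 hcTdim hcTord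
  -- `τ_* div_T(φ') = div_W(φ)` on `X`: Fulton Prop. 1.4 (b) along `π`, `Nm φ' = φ`, then `ι_W`
  have hnorm : RatFn.norm π.left φ' = φ := by
    rw [hφ'def]
    exact norm_functionFieldMap_of_isBirational (π := π₀) hπ φ
  have hπc : ⇑(AlgebraicCycle.map π.left height height cT) = fun w ↦ Scheme.ord φ w := by
    have h := Motives.map_div_eq_div_norm_holds π (d + 1) hTtop hWtop φ' hφ' cT hcTord
    rw [hnorm] at h
    exact h
  have hτc : AlgebraicCycle.map τ.left height height cT = c := by
    rw [algebraicCycleMap_congr hτleft cT,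
      algebraicCycleMap_comp π.left ι' π.left.isClosedMap ι'.isClosedMap]
    ext z
    by_cases hz : z ∈ Set.range ι'.base
    · obtain ⟨w, rfl⟩ := hz
      rw [algebraicCycleMap_apply_base_of_isClosedImmersion, hcφ]
      change _ = W.divFun φ (W.ι.base w)
      rw [W.divFun_ι_base]
      exact congrFun hπc w
    · rw [algebraicCycleMap_apply_of_notMem_range ι' _ hz, hcφ]
      exact (W.divFun_of_notMem_range φ hz).symm
  -- `[div_W φ] = τ_* [div_T φ'] = 0`
  have hsub : (⟨c, hc⟩ : ↥(Motives.cyclesOfDim X.left d)) =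
      Motives.cyclesOfDimMap d τ.left ⟨cT, hcTdim⟩ := Subtype.ext hτc.symm
  rw [hsub, cycleClass_cyclesOfDimMap hμ hT hX τ rfl hde ρT ρ ⟨cT, hcTdim⟩, hT0', map_zero]

/-! ### Isomorphisms are birational -/

/-- An isomorphism is birational. [cite: StacksProject, Tag 01RN] -/
theorem isBirational_of_isIso {X' X₀ : Scheme} (f : X' ⟶ X₀) [IsIso f] : IsBirational f := by
  refine ⟨⊤, ?_, ?_, ?_⟩
  · exact dense_univ
  · rw [Scheme.Hom.preimage_top]
    exact dense_univ
  · exact IsZariskiLocalAtTarget.restrict (P := MorphismProperty.isomorphisms Scheme)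
      (show IsIso f from inferInstance) ⊤

/-! ### Lemma 9.18 on `ℙ^{d+1}`: arbitrary `ψ`, then arbitrary `W` -/

/-- **`[div ψ] = 0` on `ℙ^{d+1}_ℂ` for every `ψ ∈ K(ℙ^{d+1})ˣ`**, granted the degree formula: the locus
where `ψ` is a unit is a non-empty open (it contains the generic point), so an automorphism `ε` of
`ℙ^{d+1}` moves the vertex into it (`ProjectiveSpace.exists_iso_left_vertex_mem`); then `ε^♯ ψ` is a unit
at the vertex, `[div ε^♯ψ] = 0` (`cycleClass_div_eq_zero_of_isUnitAt_vertex`), and `[div ψ] = ε_*[div ε^♯ψ] = 0`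
(transport along the isomorphism `ε`). [cite: VoisinHodgeII2003, Lemma 9.18]
[cite: Hartshorne1977, II Example 7.1.1] -/
theorem cycleClass_div_eq_zero_projectiveSpace_of_ord (hA : complexOrientationFamily.HasDegreeFormula)
    (d : ℕ) (ρ : ResolutionFamily (projectiveSpace (d + 1) ℂ) d)
    [IsIntegral (projectiveSpace (d + 1) ℂ).left] [IsLocallyNoetherian (projectiveSpace (d + 1) ℂ).left]
    (ψ : (projectiveSpace (d + 1) ℂ).left.functionField) (hψ : ψ ≠ 0)
    {c : AlgebraicCycle (projectiveSpace (d + 1) ℂ).left ℤ}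
    (hc : c ∈ Motives.cyclesOfDim (projectiveSpace (d + 1) ℂ).left d)
    (hcψ : ⇑c = fun z ↦ Scheme.ord ψ z) :
    cycleClass complexOrientationFamily (isSmoothProjective_projectiveSpace' (d + 1)) rfl ρ ⟨c, hc⟩ = 0 := by
  have hP : IsSmoothProjective (d + 1) (projectiveSpace (d + 1) ℂ) :=
    isSmoothProjective_projectiveSpace' (d + 1)
  haveI := irreducibleSpace_of_isSmoothProjective' hP
  -- move the vertex into the unit locus of `ψ`
  set Uψ : (projectiveSpace (d + 1) ℂ).left.Opens :=
    ⟨{x | RatFn.IsUnitAt x ψ}, RatFn.isOpen_setOf_isUnitAt ψ⟩ with hUψdef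
  have hne : ((Uψ : (projectiveSpace (d + 1) ℂ).left.Opens) : Set (projectiveSpace (d + 1) ℂ).left).Nonempty :=
    ⟨genericPoint (projectiveSpace (d + 1) ℂ).left, RatFn.isUnitAt_genericPoint hψ⟩
  obtain ⟨ε, hε⟩ := ProjectiveSpace.exists_iso_left_vertex_mem Uψ hne
  have hεunit : RatFn.IsUnitAt (ε.hom.left.base (DeJong1996.vertex d ℂ)) ψ := hε
  -- `ε` as a birational model of the whole space `W = ℙ^{d+1}`
  set W := Motives.ClosedSubvariety.top (projectiveSpace (d + 1) ℂ).left with hWdef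
  haveI : IsIso (ε.hom.left : W.carrier ⟶ W.carrier) := inferInstanceAs (IsIso ε.hom.left)
  have hπ : IsBirational (ε.hom.left : (projectiveSpace (d + 1) ℂ).left ⟶ W.carrier) :=
    isBirational_of_isIso _
  have hπw : (ε.hom.left : (projectiveSpace (d + 1) ℂ).left ⟶ W.carrier) ≫ W.ι ≫
      (projectiveSpace (d + 1) ℂ).hom = (projectiveSpace (d + 1) ℂ).hom := by
    change ε.hom.left ≫ 𝟙 _ ≫ (projectiveSpace (d + 1) ℂ).hom = (projectiveSpace (d + 1) ℂ).hom
    rw [Category.id_comp]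
    exact Over.w ε.hom
  haveI : IsLocallyNoetherian W.carrier := inferInstanceAs (IsLocallyNoetherian (projectiveSpace (d + 1) ℂ).left)
  have hW : W.dim = d + 1 := by
    rw [hWdef, Motives.ClosedSubvariety.dim_top, height_eq_of_isGenericPoint hP (genericPoint_spec _),
      Nat.cast_add_one]
  refine cycleClass_div_eq_zero_of_birational_model hA hP rfl ρ W ψ hψ hW hP ε.hom.left hπw hπ ρ ?_ hc ?_
  · intro c' hc' hc'ψ
    have hunit : RatFn.IsUnitAt (DeJong1996.vertex d ℂ)
        (RatFn.functionFieldMap (ε.hom.left : (projectiveSpace (d + 1) ℂ).left ⟶ W.carrier) ψ) :=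
      hεunit.functionFieldMap
    exact cycleClass_div_eq_zero_of_isUnitAt_vertex hA d ρ _
      ((map_ne_zero_iff _ (RatFn.functionFieldMap
        (ε.hom.left : (projectiveSpace (d + 1) ℂ).left ⟶ W.carrier)).injective).2 hψ) hunit hc' hc'ψ
  · change ⇑c = (Motives.ClosedSubvariety.top (projectiveSpace (d + 1) ℂ).left).divFun ψ
    rw [Motives.ClosedSubvariety.divFun_top]
    exact hcψ

/-- **Voisin II, Lemma 9.18 in generator form on `ℙ^{d+1}_ℂ`, from the degree formula**: for every
resolution family `ρ`, every closed subvariety `W ⊆ ℙ^{d+1}` of dimension `d + 1` (so `W = ℙ^{d+1}`) and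
every `φ ∈ K(W)ˣ`, `[div φ] = 0 ∈ H²(ℙ^{d+1}(ℂ); ℂ)` — the hypothesis predicate
`ProjectiveSpaceCycleClassDivEqZero d` of `HodgeTheory/CycleClassPrincipalDivisorOfProjectiveSpace`,
DISCHARGED granted `HasDegreeFormula` (transport along the isomorphism `ι_W⁻¹ : ℙ^{d+1} → W` to the case
`W = ℙ^{d+1}`, `cycleClass_div_eq_zero_projectiveSpace_of_ord`). [cite: VoisinHodgeII2003, Lemma 9.18]
[cite: Fulton1998, Prop. 1.4 and Lemma 19.1.2] -/
theorem projectiveSpaceCycleClassDivEqZero_of_hasDegreeFormula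
    (hA : complexOrientationFamily.HasDegreeFormula) (d : ℕ) : ProjectiveSpaceCycleClassDivEqZero d := by
  intro ρ W _ φ hφ hW c hc hcφ
  have hP : IsSmoothProjective (d + 1) (projectiveSpace (d + 1) ℂ) :=
    isSmoothProjective_projectiveSpace' (d + 1)
  haveI := irreducibleSpace_of_isSmoothProjective' hP
  haveI : IsIntegral (projectiveSpace (d + 1) ℂ).left := IsSmoothProjective.isIntegral_holds hP
  haveI : LocallyOfFiniteType (projectiveSpace (d + 1) ℂ).hom := locallyOfFiniteType_of_isSmoothProjective hP
  haveI : IsLocallyNoetherian (projectiveSpace (d + 1) ℂ).left :=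
    LocallyOfFiniteType.isLocallyNoetherian (projectiveSpace (d + 1) ℂ).hom
  -- `ι_W` is an isomorphism (`dim W = dim ℙ^{d+1}`), and `ι_W⁻¹` is a birational model
  have hiso : IsIso W.ι :=
    W.isIso_ι_of_dim_eq (height_eq_of_isGenericPoint hP (genericPoint_spec _))
      (by rw [Nat.cast_add_one]; exact hW)
  haveI := hiso
  have hπw : inv W.ι ≫ W.ι ≫ (projectiveSpace (d + 1) ℂ).hom = (projectiveSpace (d + 1) ℂ).hom := by
    rw [IsIso.inv_hom_id_assoc]
  have hπ : IsBirational (inv W.ι) := isBirational_of_isIso _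
  exact cycleClass_div_eq_zero_of_birational_model hA hP rfl ρ W φ hφ hW hP (inv W.ι) hπw hπ ρ
    (fun c' hc' hc'φ ↦ cycleClass_div_eq_zero_projectiveSpace_of_ord hA d ρ _
      ((map_ne_zero_iff _ (RatFn.functionFieldMap (inv W.ι)).injective).2 hφ) hc' hc'φ) hc hcφ

/-! ### Lemma 9.18 for the complex orientations from the degree formula and the spanning hypothesis -/

/-- **Voisin II, Lemma 9.18 in generator form for the complex orientation family**
(`complexOrientationFamily.CycleClassDivEqZero`: `[div φ] = 0` for every closed subvariety `W` of
dimension `d + 1` of every smooth projective `X` and every `φ ∈ K(W)ˣ`), **from Fulton's degree formula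
and the spanning of the rational `(d,d)`-classes of `(d+1)`-folds by pull-backs from `ℙ^{d+1}`**:
desingularise `W` (`cycleClassDivEqZero_of_smooth`); on the smooth projective `(d+1)`-fold `T` the class
`[div φ]` is rational of type `(1,1)` and pairs to zero with every rational `(d,d)`-class — these are
spanned by the `F^* u`, `F : T ⟶ ℙ^{d+1}`, and `⟨[div φ] ∪ F^*u, [T]⟩ = ⟨[F_* div φ] ∪ u, [ℙ^{d+1}]⟩ = 0` by
Lemma 9.18 on `ℙ^{d+1}` (`projectiveSpaceCycleClassDivEqZero_of_hasDegreeFormula`) — so it vanishes by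
the Hodge index theorem (`cycleClass_div_eq_zero_of_projectiveSpace`).
[cite: VoisinHodgeII2003, Lemma 9.18 and Prop. 9.21 (ii)] [cite: Fulton1998, Lemma 19.1.2]
[cite: BrosnanFangNiePearlstein2009, §6 (6.1)] -/
theorem cycleClassDivEqZero_complexOrientationFamily_of_spanning
    (hA : complexOrientationFamily.HasDegreeFormula)
    (hS : ∀ (d : ℕ) (T : Motives.SchemeOver ℂ), IsSmoothProjective (d + 1) T →
      TopHodgeClassesSpannedByPullbacks d T) :
    complexOrientationFamily.CycleClassDivEqZero :=
  cycleClassDivEqZero_of_smooth hA fun d T hT ρ W _ φ hφ hW _ hc hcφ ↦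
    cycleClass_div_eq_zero_of_projectiveSpace hA (projectiveSpaceCycleClassDivEqZero_of_hasDegreeFormula hA d)
      hT (hS d T hT) ρ W φ hφ hW hc hcφ

end HodgeTheory

end Literature.AlgebraicGeometry.HodgeTheory

end
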